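import Literature.Analysis.ValidatedNumerics.IntervalFunctions

/-!
# Route `AnisotropyChord` / H0 rotor rung, LEVEL 2: first-order (slope) interval arithmetic for `RExpr` —
the computable layer

Krawczyk–Neumaier SLOPE ARITHMETIC (Neumaier 1990, §2.3, Thm. 2.3.8 / Prop. 2.3.9: the inclusion algebra
`L_n` of linear enclosures) for the tree's term language `RExpr` of `Literature.Analysis.ValidatedNumerics.IntervalFunctions`,
specialised to TWO moving coordinates and extended by an absolute remainder so that the non-smooth constructors
`|·|, √, min, max` are covered without calculus.  A slope datum `SD = (c, r, s₂, s₃, e)` (five rational intervals)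
describes a real function `f` at a pair of points `(x, z)` of a box that differ only in two distinguished
coordinates, `x₂ − z₂ = δ₂`, `x₃ − z₃ = δ₃`:  `f(z) ∈ c`, `f(x) ∈ r`, and `f(x) − f(z) = š₂δ₂ + š₃δ₃ + ř` for some
`š₂ ∈ s₂, š₃ ∈ s₃, ř ∈ e` (`SD.Holds`, in the companion soundness files `…L2SlopeSound/B`).  This file is the COMPUTABLE layer:
the sign-aware interval product `mulZ` (two endpoint products whenever a factor has a sign — the rational comparisons of the
generic Moore product dominate kernel time), the node operations `SD.add/sub/neg/mul/sq/inv?/abs/sqrt/min/max` (Neumaier's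
rules: product `s = r_f·s_g + c_g·s_f`, square `(c_f + r_f)·s_f`, reciprocal `−s_f/(r_f c_f)`, root `s_f/(√r_f + √c_f)`,
absolute value by sign or symmetric hull, `min/max` by dominance or the interval hull of the two data; fast paths for STILL
operands, whose increment vanishes), the zero-order fallback `(c, r, 0, 0, r − c)` used by `√` at arguments that may vanish,
the hull of two data (`SD.hull`, for a quantity known only to lie between two terms) and the centred bounds
`SD.ub/lb D₂ D₃ = (c + s₂·D₂ + s₃·D₃ + e).snd/fst`.  The evaluator `sdEnclose` and its soundness are in `…L2SlopeEval`.
DESIGN NOTE (measured): a per-node "take the zero-order fallback when locally narrower" heuristic DESTROYS the method — the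
fallback moves the increment into the remainder, which never cancels downstream (cell value 0.467 < zero order 0.478); with pure
slope rules the margin `cmin·U′ − N₁′` keeps the `ν`-slopes of `N₁′` and `U′` correlated and certifies `cmin = 0.575` on the same cell.
Prover seat `hubbard-h0-rotor-p2` g6; helper for piece A = stmt-HubbardSuperconductivity-23918 of rung 19089
(`--supports`, helper class).  Nothing here proves superconductivity in the Hubbard model; generic computable helper
definitions serving ONE conditional reduction (the GM₃ ∀L certificate); the rotor TARGET as originally worded stays FALSE
(g15 verdict).  Mathlib + the tree only; no sorry.
-/

set_option linter.dupNamespace false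
set_option autoImplicit false

open Literature.Analysis.ValidatedNumerics NonemptyInterval

namespace Summit.HubbardSuperconductivity.HubbardSuperconductivity.Theorems.AnisotropyChord.Transfer.Fibre3.L2

/-! ## Interval helpers -/

/-- the point interval `[0, 0]`. -/
def zI : NonemptyInterval ℚ := pure 0

/-- interval hull `[min lo lo', max hi hi']`. -/
def hullI (I J : NonemptyInterval ℚ) : NonemptyInterval ℚ :=
  ⟨(min I.fst J.fst, max I.snd J.snd), (min_le_left _ _).trans (I.fst_le_snd.trans (le_max_left _ _))⟩

/-- symmetric hull `[−m, m]`, `m = max |lo| |hi|` (contains `θ·y` for every `y ∈ I`, `|θ| ≤ 1`). -/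
def symI (I : NonemptyInterval ℚ) : NonemptyInterval ℚ :=
  ⟨(-(max |I.fst| |I.snd|), max |I.fst| |I.snd|), by
    have h : 0 ≤ max |I.fst| |I.snd| := le_max_of_le_left (abs_nonneg _)
    linarith⟩

/-- sign-aware interval product (Moore 1966, §2.2 case table): two endpoint products, with the endpoint order known from
the signs, whenever a factor has a known sign; the four-product hull only when both factors straddle `0` — avoids the rational
comparisons of the generic Moore product (the dominant kernel cost). -/
def mulZ (I J : NonemptyInterval ℚ) : NonemptyInterval ℚ :=
  if hI : 0 ≤ I.fst then
    if hJ : 0 ≤ J.fst then ⟨(I.fst * J.fst, I.snd * J.snd), by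
        nlinarith [mul_le_mul_of_nonneg_left J.fst_le_snd hI,
          mul_le_mul_of_nonneg_right I.fst_le_snd (hJ.trans J.fst_le_snd)]⟩
    else if hJ' : J.snd ≤ 0 then ⟨(I.snd * J.fst, I.fst * J.snd), by
        nlinarith [mul_le_mul_of_nonpos_right I.fst_le_snd (J.fst_le_snd.trans hJ'),
          mul_le_mul_of_nonneg_left J.fst_le_snd hI]⟩
    else ⟨(I.snd * J.fst, I.snd * J.snd), by nlinarith [mul_le_mul_of_nonneg_left J.fst_le_snd (hI.trans I.fst_le_snd)]⟩
  else if hI' : I.snd ≤ 0 then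
    if hJ : 0 ≤ J.fst then ⟨(I.fst * J.snd, I.snd * J.fst), by
        nlinarith [mul_le_mul_of_nonpos_left J.fst_le_snd (I.fst_le_snd.trans hI'),
          mul_le_mul_of_nonneg_right I.fst_le_snd hJ]⟩
    else if hJ' : J.snd ≤ 0 then ⟨(I.snd * J.snd, I.fst * J.fst), by
        nlinarith [mul_le_mul_of_nonpos_left J.fst_le_snd hI',
          mul_le_mul_of_nonpos_right I.fst_le_snd (J.fst_le_snd.trans hJ')]⟩
    else ⟨(I.fst * J.snd, I.fst * J.fst), by nlinarith [mul_le_mul_of_nonpos_left J.fst_le_snd (I.fst_le_snd.trans hI')]⟩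
  else
    if hJ : 0 ≤ J.fst then ⟨(I.fst * J.snd, I.snd * J.snd), by
        nlinarith [mul_le_mul_of_nonneg_right I.fst_le_snd (hJ.trans J.fst_le_snd)]⟩
    else if hJ' : J.snd ≤ 0 then ⟨(I.snd * J.fst, I.fst * J.fst), by
        nlinarith [mul_le_mul_of_nonpos_right I.fst_le_snd (J.fst_le_snd.trans hJ')]⟩
    else I.mooreMul J

/-! ## Slope data -/

/-- a slope datum: centre value `c ∋ f(z)`, range `r ∋ f(x)`, slopes `s₂, s₃` and remainder `e` with
`f(x) − f(z) ∈ s₂·δ₂ + s₃·δ₃ + e` (see `SD.Holds`). -/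
structure SD where
  /-- encloses the value at the centre point `z` -/
  c : NonemptyInterval ℚ
  /-- encloses the value at the point `x` -/
  r : NonemptyInterval ℚ
  /-- slope w.r.t. the first moving coordinate -/
  s2 : NonemptyInterval ℚ
  /-- slope w.r.t. the second moving coordinate -/
  s3 : NonemptyInterval ℚ
  /-- absolute remainder -/
  e : NonemptyInterval ℚ
  deriving DecidableEq, Inhabited

namespace SD

/-- datum of a rational constant. -/
def const (q : ℚ) : SD := ⟨pure q, pure q, zI, zI, zI⟩
/-- datum of a coordinate that does NOT move (`x_i = z_i ∈ I`). -/
def still (I : NonemptyInterval ℚ) : SD := ⟨I, I, zI, zI, zI⟩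
/-- datum of the first moving coordinate: centre `q`, range `I`, slope `1`. -/
def mov2 (q : ℚ) (I : NonemptyInterval ℚ) : SD := ⟨pure q, I, pure 1, zI, zI⟩
/-- datum of the second moving coordinate. -/
def mov3 (q : ℚ) (I : NonemptyInterval ℚ) : SD := ⟨pure q, I, zI, pure 1, zI⟩

/-- the linear part `s₂·D₂ + s₃·D₃ + e` on an increments box. -/
def lin (D2 D3 : NonemptyInterval ℚ) (A : SD) : NonemptyInterval ℚ := mulZ A.s2 D2 + mulZ A.s3 D3 + A.e
/-- ★ the centred upper bound `(c + s₂·D₂ + s₃·D₃ + e).snd` of `f(x)`. -/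
def ub (D2 D3 : NonemptyInterval ℚ) (A : SD) : ℚ := (A.c + A.lin D2 D3).snd
/-- the centred lower bound `(c + s₂·D₂ + s₃·D₃ + e).fst` of `f(x)`. -/
def lb (D2 D3 : NonemptyInterval ℚ) (A : SD) : ℚ := (A.c + A.lin D2 D3).fst

/-- the datum carries no increment at all (`f(x) = f(z)`). -/
def isStill (A : SD) : Bool := decide (A.s2 = zI) && decide (A.s3 = zI) && decide (A.e = zI)
/-- the always-valid zero-order fallback `(c, r, 0, 0, r − c)`. -/
def fb (A : SD) : SD := ⟨A.c, A.r, zI, zI, A.r - A.c⟩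
/-- both data are still with centre = range (a subterm that does not move at all): its value may be computed once. -/
def both0 (A B : SD) : Bool := A.isStill && B.isStill && decide (A.c = A.r) && decide (B.c = B.r)
/-- sum (one interval sum for a pair of non-moving data). -/
def add (prec : ℕ) (A B : SD) : SD :=
  if both0 A B then let r := (A.r + B.r).roundOut prec; ⟨r, r, zI, zI, zI⟩
  else ⟨(A.c + B.c).roundOut prec, (A.r + B.r).roundOut prec, (A.s2 + B.s2).roundOut prec, (A.s3 + B.s3).roundOut prec,
    (A.e + B.e).roundOut prec⟩
/-- difference. -/
def sub (prec : ℕ) (A B : SD) : SD :=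
  if both0 A B then let r := (A.r - B.r).roundOut prec; ⟨r, r, zI, zI, zI⟩
  else ⟨(A.c - B.c).roundOut prec, (A.r - B.r).roundOut prec, (A.s2 - B.s2).roundOut prec, (A.s3 - B.s3).roundOut prec,
    (A.e - B.e).roundOut prec⟩
/-- negation. -/
def neg (A : SD) : SD := ⟨-A.c, -A.r, -A.s2, -A.s3, -A.e⟩
/-- product (Neumaier: `h(x) − h(z) = f(x)(g(x) − g(z)) + (f(x) − f(z))g(z)`), with fast paths when a factor is still
(then one of the two slope products vanishes; for two still factors with equal centre/range the value is computed once). -/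
def mul (prec : ℕ) (A B : SD) : SD :=
  if B.isStill then
    let r := (mulZ A.r B.r).roundOut prec
    if both0 A B then ⟨r, r, zI, zI, zI⟩
    else ⟨(mulZ A.c B.c).roundOut prec, r, (mulZ B.c A.s2).roundOut prec, (mulZ B.c A.s3).roundOut prec,
      (mulZ B.c A.e).roundOut prec⟩
  else if A.isStill then
    ⟨(mulZ A.c B.c).roundOut prec, (mulZ A.r B.r).roundOut prec, (mulZ A.r B.s2).roundOut prec,
      (mulZ A.r B.s3).roundOut prec, (mulZ A.r B.e).roundOut prec⟩
  else
    ⟨(mulZ A.c B.c).roundOut prec, (mulZ A.r B.r).roundOut prec,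
      (mulZ A.r B.s2 + mulZ B.c A.s2).roundOut prec, (mulZ A.r B.s3 + mulZ B.c A.s3).roundOut prec,
      (mulZ A.r B.e + mulZ B.c A.e).roundOut prec⟩
/-- square (`f(x)² − f(z)² = (f(x) + f(z))(f(x) − f(z))`). -/
def sq (prec : ℕ) (A : SD) : SD :=
  if A.isStill then
    let r := A.r.sqI.roundOut prec
    if A.c = A.r then ⟨r, r, zI, zI, zI⟩ else ⟨A.c.sqI.roundOut prec, r, zI, zI, zI⟩
  else
    let w := A.r + A.c
    ⟨A.c.sqI.roundOut prec, A.r.sqI.roundOut prec, (mulZ w A.s2).roundOut prec, (mulZ w A.s3).roundOut prec,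
      (mulZ w A.e).roundOut prec⟩
/-- reciprocal (`f(x)⁻¹ − f(z)⁻¹ = −f(x)⁻¹f(z)⁻¹(f(x) − f(z))`); `none` if `0 ∈ c` or `0 ∈ r`. -/
def inv? (prec : ℕ) (A : SD) : Option SD :=
  match A.c.invI?, A.r.invI? with
  | some C, some R =>
    let w := -(mulZ R C)
    some ⟨C.roundOut prec, R.roundOut prec, (mulZ w A.s2).roundOut prec, (mulZ w A.s3).roundOut prec,
      (mulZ w A.e).roundOut prec⟩
  | _, _ => none
/-- absolute value: by sign when both values have a known common sign, else the symmetric hull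
(`||f(x)| − |f(z)|| ≤ |f(x) − f(z)|`). -/
def abs (A : SD) : SD :=
  if 0 ≤ A.c.fst ∧ 0 ≤ A.r.fst then ⟨A.c.absI, A.r.absI, A.s2, A.s3, A.e⟩
  else if A.c.snd ≤ 0 ∧ A.r.snd ≤ 0 then ⟨A.c.absI, A.r.absI, -A.s2, -A.s3, -A.e⟩
  else ⟨A.c.absI, A.r.absI, symI A.s2, symI A.s3, symI A.e⟩
/-- square root (`√f(x) − √f(z) = (f(x) − f(z))/(√f(x) + √f(z))` when both roots are positive; else fallback). -/
def sqrt (prec iters : ℕ) (A : SD) : SD :=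
  let C := A.c.sqrtI prec iters
  let R := A.r.sqrtI prec iters
  if A.isStill then ⟨C, R, zI, zI, zI⟩
  else if 0 < C.fst ∧ 0 < R.fst then
    match (R + C).invI? with
    | some W => ⟨C, R, (mulZ W A.s2).roundOut prec, (mulZ W A.s3).roundOut prec, (mulZ W A.e).roundOut prec⟩
    | none => ⟨C, R, zI, zI, R - C⟩
  else ⟨C, R, zI, zI, R - C⟩
/-- minimum: the dominated datum if one branch is below the other at both points, else the hull of the two data
(the increment of a `min` lies between the two increments). -/
def min (A B : SD) : SD :=
  if A.r.snd ≤ B.r.fst ∧ A.c.snd ≤ B.c.fst then A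
  else if B.r.snd ≤ A.r.fst ∧ B.c.snd ≤ A.c.fst then B
  else ⟨A.c.minI B.c, A.r.minI B.r, hullI A.s2 B.s2, hullI A.s3 B.s3, hullI A.e B.e⟩
/-- maximum: the dominating datum if one branch dominates at both points, else the hull of the two data. -/
def max (A B : SD) : SD :=
  if B.r.snd ≤ A.r.fst ∧ B.c.snd ≤ A.c.fst then A
  else if A.r.snd ≤ B.r.fst ∧ A.c.snd ≤ B.c.fst then B
  else ⟨A.c.maxI B.c, A.r.maxI B.r, hullI A.s2 B.s2, hullI A.s3 B.s3, hullI A.e B.e⟩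
/-- componentwise hull of two data (a convex combination of two enclosed functions). -/
def hull (A B : SD) : SD := ⟨hullI A.c B.c, hullI A.r B.r, hullI A.s2 B.s2, hullI A.s3 B.s3, hullI A.e B.e⟩

end SD

end Summit.HubbardSuperconductivity.HubbardSuperconductivity.Theorems.AnisotropyChord.Transfer.Fibre3.L2
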